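import Summits.BirchSwinnertonDyer.Rank1Residual.X11b.RouteR1BDPValueRecord
import HarnessLib

/-!
# X11b, route R1 at `p ≥ 5` — the open input in FRAME FORM (H3∃): per datum ONE BDP frame carrying
# the interpolation property, the value at `𝟙` and the main-conjecture equality; the record on ALL
# of `R1Population ∩ {r_an = 1}` from 7 PUBLISHED + 5 CITED facts and this one typed input

HONEST FRAMING (cell `b2b-bsdres`, run/shared/lean/b2b/bsd-rank1-residual/, verbatim in every
file): the goal of the cell is to DELETE the COMBINATION-SHAPED residual classes of the
Birch–Swinnerton-Dyer formula for ALL analytic-rank `≤ 1` elliptic curves over `ℚ` — "full BSD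
formula for every rank `≤ 1` curve in class `C`" assembled STRICTLY from published theorems — so
that the rank-`≤ 1` remainder becomes exactly the CONSTRUCTION-SHAPED classes, which are TYPED
(missing-input `Prop`s), NOT attempted. This is not "finishing BSD". Sub-cell
`b2b-bsdres-multr1-p1` (X11b, route R1, gen 22); a RESEARCH ROUTE; no claim beyond the stated
class; X11b stays CONSTRUCTION-SHAPED; nothing here changes a label; ONE `Prop`-valued SHAPE with a
body (nothing asserted) and theorems; no named fact; no `sorry`; every result using the OPEN shape is
CONDITIONAL.

## Why this file (attach-point hygiene for the day the main conjecture is refereed)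

Gen 21's record `R1.bsdp_of_imcEq_record` reads: on SEMISTABLE `R1Population ∩ {r_an = 1}`,
`BSD(E,p)` from 8 PUBLISHED facts (among them `h32` = Castella 2018 Thms. 3.1–3.2 in the registry's
∃∧-currency: "there EXIST CM periods `Ω_K, Ω_p` and `L ∈ R₀⟦T⟧` with the interpolation property
`IsBDPLFunction …` AND the value at `𝟙`") + 5 CITED facts + ONE OPEN input
H3 = `R1.IMCEqOnTree W p`, which asks the main-conjecture equality `Ch_Λ(X_ac)·R₀⟦T⟧ = (L)` for EVERY
frame `(Ω_K, Ω_p, L)` satisfying the interpolation property. The statement that will be refereed —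
erratum Thm. 1.1 = [Castella, arXiv:2409.01360, Thm. 3.1]: "`X_𝔭` is `Λ`-torsion and
`char_Λ(X_𝔭)Λ_{R₀} = (L_𝔭(f))`" — concerns Castella's OWN `L_𝔭(f)`, an object the tree does not
construct; in the tree's currency it is an EXISTENTIAL statement about ONE frame (the same frame as
Thms. 3.1–3.2, which are about the same `L_𝔭(f)`). H3 in its ∀-frame form would follow from it only
through a UNIQUENESS theorem for the interpolant (two frames with the same data coincide), which
needs a supply of anticyclotomic Hecke characters the tree does not have. Hence the honest attach
point is the ∃∧-transcription, per datum, of (Thm. 3.1 ∧ Thm. 3.2 ∧ erratum Thm. 1.1):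

* **`R1.IMCEqFrameOnTree W p`** (H3∃, OPEN shape, claim-tagged): at every datum of route R1 read in
  the published fact's currency (an erratum field `K` for `q`, a parametrisation datum `Dt` at level
  `N_E` with `p ∤ c`, a Heegner datum `H`, the Heegner point `P` read through Mathlib's embedding of
  an infinite place `w₀`, of infinite order), every anticyclotomic `(κ, γ)`, every embedding datum
  `ι' : ℚ̄_p ≃ ℂ` and every `e : K → ℚ_p` inducing `𝔭_{ι'}`: THERE IS a frame
  `(Ω_K ≠ 0, Ω_p ∈ R₀ˣ, L ∈ R₀⟦T⟧)` with `IsBDPLFunction ι' 𝔭_{ι'} κ γ f Ω_K Ω_p L` (Thm. 3.1) ∧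
  `R1.BDPValueAtOneOnTreeAt W p e P L (a_p(E))` (Thm. 3.2) ∧ `R1.IMCEqOnTreeAt W p κ 𝔭_{ι'} γ L`
  (erratum Thm. 1.1).
* `R1.imcEqFrameOnTree_of_thm32_of_imcEqOnTree` — on a SEMISTABLE pair, `h32 ∧ H3 ⟹ H3∃`: the new
  typed input is WEAKER than gen 21's inputs (so this record supersedes nothing and loses nothing).
* **`R1.openInputOnTreeAt_of_imcEqFrame`** — `hmod`, `hGZK`, the five cited control facts, one
  datum `ι` and H3∃ ⟹ `R1OpenInputOnTreeAt W p`, with NO semistability hypothesis and NO `h32`: the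
  per-datum argument of gen 21 (`𝔭 = 𝔭_{ι'}` for `ι' ∈ {ι, ι∘conj}`; the datum's complex embedding is
  `w₀.embedding ∘ τ`, `τ ∈ Gal(K/ℚ)`, so the Galois conjugate `τ_* P` is the Heegner point in the
  fact's reading; CTL₀ from gen 18; `ord_p log(τ_* P) = ord_p log P` by `rank_ℤ E(K) = 1`) run on the
  ONE frame H3∃ provides; `…_of_imcEqFrame'` without the datum (Steinitz).
* **`R1.bsdp_of_imcEqFrame_record`** — THE RECORD in frame form: for every globally minimal elliptic
  `W/ℚ` and prime `p` on `R1Population` with `ord_{s=1} L(E,s) = 1`, `BSD(E,p)` from SEVEN PUBLISHED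
  named facts (Gross–Zagier I.7.3, GZK, Skinner 2016 Thm. C, modularity, Cai–Shu–Tian, Friedberg–
  Hoffstein, Mazur's Manin constant), the FIVE CITED cohomological facts, and H3∃ — semistable OR
  NOT. What is OPEN in H3∃, honestly: on SEMISTABLE pairs the frame with (Thm. 3.1 ∧ Thm. 3.2) EXISTS
  by the registered fact `h32`, so the open content is exactly "the main conjecture holds at a frame
  satisfying Thm. 3.2" = erratum Thm. 1.1 for Castella's `L_p(f)` (⇐ [FW21, Thm. 4.41], PREPRINT);
  on NON-semistable pairs H3∃ ALSO contains the existence and value halves, which are NOT in refereed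
  print there (Cas18 §§2–3 are written under "`E` semistable"; [Castella 2024, Thm. 3.1 with §2.3]
  states all three for any `E` with multiplicative `p > 3` — PREPRINT). Semistability thus lives in
  the binders of whichever Literature fact will discharge H3∃, not in the Summits theorem.
* `R1.openInput_and_bsdp_of_imcEqFrame_record` — both sides of gen 19's tightness hold under H3∃.

CONDITIONAL on H3∃ (open); deletes nothing; X11b stays CONSTRUCTION-SHAPED; no label change.

References: [Castella2018] Thms. 2.3, 3.1, 3.2, display (3.2), §5 (arXiv:1704.06608 pp. 5, 9, 12);
[Castella2018Erratum] Thm. 1.1 (p. 1); [Castella2024] F. Castella, *Exceptional zeros for Heegner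
points and `p`-converse …*, arXiv:2409.01360, Thm. 3.1 and §2.3 (pp. 6–7); [FouquetWan2021] Thm. 4.41.
-/

noncomputable section

open scoped Classical

open WeierstrassCurve NumberField IsDedekindDomain Field PowerSeries
open Literature.NumberTheory.EllipticCurves Literature.NumberTheory.EllipticCurves.GreenbergSelmer
open Literature.NumberTheory.EllipticCurves.ModularForms
open Literature.NumberTheory.EllipticCurves.Rank1Residual
open Literature.NumberTheory.EllipticCurves.Rank1Residual.Typed
open Literature.NumberTheory.EllipticCurves.Castella2018
open Literature.NumberTheory.GaloisRepresentations
open Literature.NumberTheory.GaloisCohomology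
open Summit.BirchSwinnertonDyer.Rank1Residual.X11b.AcSelmer
open Summit.BirchSwinnertonDyer.Rank1Residual.X11b.Halves

namespace Summit.BirchSwinnertonDyer.Rank1Residual.X11b

/-! ### §1 The open input in frame form (H3∃) -/

section Shape

variable (W : WeierstrassCurve ℚ) [W.IsElliptic] [W.IsGloballyMinimal] (p : ℕ) [Fact p.Prime]

/-- **H3∃ — route R1's open input in FRAME FORM (OPEN shape).** At every datum of route R1 read in
the currency of the registered fact `Castella2018.thm32_exists_isBDPLFunction_valueAtOne` — the
A′-hypotheses `ErratumHypotheses W p`, `r_an = 1`, a non-split multiplicative `q ≠ p` with `E[p]`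
ramified (`p ∤ v_q(Δ)`), an erratum field `K` for `q` with [Cas20, §2.5]'s standing hypotheses at
the tame level, a parametrisation datum `Dt` at level `N_E` with `p ∤ c` (display (3.2)), a Heegner
datum `H`, a point `P` of infinite order with `P.map w₀.embedding = heegnerPointComplex Dt H` for an
infinite place `w₀` —, every anticyclotomic `ℤ_p`-extension `κ` with topological generator `γ`,
every embedding datum `ι' : ℚ̄_p ≃ ℂ` and every `e : K → ℚ_p` inducing the prime `𝔭_{ι'}`
(`primeOfEmbeddingDatum p ι' w₀.embedding`): THERE EXISTS a frame `(Ω_K ≠ 0, Ω_p ∈ R₀ˣ, L ∈ R₀⟦T⟧)`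
with the interpolation property `IsBDPLFunction ι' 𝔭_{ι'} κ γ f Ω_K Ω_p L` for the newform `f` of
`Dt` [Cas18 Thm. 3.1], the value at `𝟙` `L(𝟙) = u·((1 − a_p(E) p⁻¹)·log_{ω_E} P)²`
[Cas18 Thm. 3.2, `R1.BDPValueAtOneOnTreeAt`] and the main-conjecture EQUALITY
`Ch_Λ(X_ac^∅(E[p^∞]))·R₀⟦T⟧ = (L)` for the constructed `X_ac` at `𝔭_{ι'}` [erratum Thm. 1.1,
`R1.IMCEqOnTreeAt`]. This is the ∃∧-transcription of "Thm. 3.1 ∧ Thm. 3.2 ∧ erratum Thm. 1.1" (one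
object `L_p(f)`), i.e. the currency in which the refereed statement can be typed; on semistable pairs
its first two conjuncts are the registered PUBLISHED fact, on non-semistable pairs they are in print
only as [Castella 2024, §2.3] (PREPRINT). A predicate on `(W, p)`; NEVER a theorem in this cell; every
result using it is CONDITIONAL. [claim: Castella2018Erratum, status: under-review]
[cite: Castella2018, Thm. 3.1, display (3.2) and Thm. 3.2 (arXiv:1704.06608 p. 9) (shape only; nothing asserted)] -/
def R1.IMCEqFrameOnTree : Prop :=
  ∀ [NeZero (W.conductorNorm ℤ)] (q : ℕ) [Fact q.Prime] (K : Type) [Field K] [NumberField K]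
    (Dt : ModularParametrizationData W (W.conductorNorm ℤ))
    (H : HeegnerDatum (W.conductorNorm ℤ) (NumberField.discr K)) (w₀ : InfinitePlace K)
    (P : (W.baseChange K).toAffine.Point), ErratumHypotheses W p → W.analyticRank = 1 →
    q ≠ p → Mult W q → ¬ W.HasSplitMultiplicativeReductionAtPrime q →
    ¬ p ∣ padicValInt q W.minimalDiscriminantInt → IsErratumField W K q →
    Cas20Standing K p (W.conductorNorm ℤ / p) →
    WeierstrassCurve.Affine.Point.map w₀.embedding.toRatAlgHom P = heegnerPointComplex Dt H →
    ¬ (p : ℤ) ∣ Dt.c → ¬ IsOfFinAddOrder P →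
    ∀ (κ : ZpExtension K p), κ.IsAnticyclotomic →
      ∀ (γ : Field.absoluteGaloisGroup K) [Fact (κ.IsTopGenerator γ)] (ι' : PadicAlgCl p ≃+* ℂ)
        (e : K →+* ℚ_[p]),
        (∀ k : 𝓞 K, k ∈ (primeOfEmbeddingDatum p ι' w₀.embedding).asIdeal ↔ ‖e (k : K)‖ < 1) →
        ∃ (ΩK : ℂ) (Ωp : (unrIntegers p)ˣ) (L : UnrSeries p), ΩK ≠ 0 ∧
          IsBDPLFunction ι' (primeOfEmbeddingDatum p ι' w₀.embedding) κ γ Dt.f ΩK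
            ((Ωp : unrIntegers p) : ℂ_[p]) L ∧
          R1.BDPValueAtOneOnTreeAt W p e P L (W.LFunction p) ∧
          R1.IMCEqOnTreeAt W p κ (primeOfEmbeddingDatum p ι' w₀.embedding) γ L

end Shape

/-! ### §2 H3∃ is weaker than gen 21's inputs on semistable pairs -/

section FromGen21

variable {W : WeierstrassCurve ℚ} [W.IsElliptic] [W.IsGloballyMinimal] {p : ℕ} [Fact p.Prime]

/-- **`h32 ∧ H3 ⟹ H3∃` on a semistable pair.** The registered fact (Cas18 Thms. 3.1–3.2) supplies,
at each datum read through `w₀.embedding`, a frame with the interpolation property and the value at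
`𝟙` (`R1.exists_frame_bdpValueAtOneOnTreeAt_of_thm32`, gen 21); gen 21's ∀-frame input H3
(`R1.IMCEqOnTree W p`) supplies the main-conjecture equality AT THAT frame. So the frame form is
implied by, and not stronger than, the gen-21 inputs; composing with `R1.bsdp_of_imcEqFrame_record`
below returns EXACTLY gen 21's record `R1.bsdp_of_imcEq_record` (not restated: same statement).
CONDITIONAL on H3 (open).
[cite: Castella2018, Thm. 3.1, display (3.2) and Thm. 3.2 (arXiv:1704.06608 p. 9)]
[cite: Castella2018Erratum, Thm. 1.1 (p. 1)] -/
theorem R1.imcEqFrameOnTree_of_thm32_of_imcEqOnTree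
    (h32 : thm32_exists_isBDPLFunction_valueAtOne) (hss : Semistable W)
    (h3 : R1.IMCEqOnTree W p) : R1.IMCEqFrameOnTree W p := by
  intro _ q _ K _ _ Dt H w₀ P hE hr hqp hmq hns hvq hK hCas hP hc hinf κ hκ γ _ ι' e he
  obtain ⟨ΩK, Ωp, L, hΩ, hL, h2⟩ :=
    R1.exists_frame_bdpValueAtOneOnTreeAt_of_thm32 h32 ι' Dt H hE hss hqp hK hc w₀ hP κ hκ γ he
  exact ⟨ΩK, Ωp, L, hΩ, hL, h2,
    h3 q K Dt H w₀.embedding P hE hr hqp hmq hns hvq hK hCas hP hc hinf Dt.f Dt.isNewformOf κ hκ γ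
      ι' w₀ ΩK Ωp L hL⟩

end FromGen21

/-! ### §3 The open input of route R1 from H3∃ — no semistability, no `h32` -/

section ClassLevel

variable {W : WeierstrassCurve ℚ} [W.IsElliptic] [W.IsGloballyMinimal] {p : ℕ} [Fact p.Prime]

/-- **Route R1's open input FROM H3∃ (any pair on the route, `p ≥ 5`).** Given `hmod` (modularity),
`hGZK`, the CITED cohomological facts of the control theorem (`hPT`, `hPT2`, `hEP`, `hcd`, `hBr` —
which make `R1ControlOnTreeAt W p` a THEOREM, gen 18), ONE embedding datum `ι : ℚ̄_p ≃ ℂ`, and the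
typed open input in frame form H3∃: `R1OpenInputOnTreeAt W p` — at EVERY datum, every anticyclotomic
`(κ, γ)` and EVERY degree-one `𝔭 ∣ p` with THE embedding `embAt K p 𝔭`. Per datum (gen 21's
argument on the one frame H3∃ provides): `𝔭 = 𝔭_{ι'}` for `ι' ∈ {ι, ι ∘ conj}`
(`eq_primeOfEmbeddingDatum_or_eq_trans_starRingAut`); the datum's complex embedding is
`w₀.embedding ∘ τ` for a `τ ∈ Gal(K/ℚ)` (`ComplexEmbedding.exists_comp_symm_eq_of_comp_eq`), so
`τ_* P` — again of infinite order — is the Heegner point in the fact's reading; `embAt K p 𝔭` induces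
`𝔭`; the frame at `(w₀, τ_* P, κ, γ, ι', embAt)` gives H2 and H3 for ONE `L`, CTL₀ comes from gen 18,
`R1.imcWaldspurgerOnTreeAt_of_halves` assembles, and `ord_p log_{ω_E}(τ_* P) = ord_p log_{ω_E} P`
(`rank_ℤ E(K) = 1` on an erratum field, `τ² = 1`, `p ≠ 2`). NO semistability and NO `h32` are used.
CONDITIONAL on H3∃ (open). [cite: Castella2018, Thms. 2.3, 3.1, 3.2 and §5 (arXiv:1704.06608 pp. 5, 9, 12)]
[cite: Castella2018Erratum, Thm. 1.1 (p. 1)] -/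
theorem R1.openInputOnTreeAt_of_imcEqFrame
    (hmod : exists_isNewformOf) (hGZK : rank_eq_analyticRank_of_analyticRank_le_one)
    (hPT : ∀ (K : Type) [Field K] [NumberField K], poitouTate_selmerStructure_duality K)
    (hPT2 : ∀ (K : Type) [Field K] [NumberField K], poitouTate_sha_tateDual K)
    (hEP : ∀ (K : Type) [Field K] [NumberField K] (v : HeightOneSpectrum (𝓞 K)),
      localEulerPoincareCharacteristic (v.adicCompletion K))
    (hcd : fieldCdLE_two_of_numberField)
    (hBr : ∀ (K : Type) [Field K] [NumberField K] (p : ℕ) [Fact p.Prime],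
      ZpExtension.decomp_not_le_kerSubgroup_of_isAnticyclotomic K p)
    (ι : PadicAlgCl p ≃+* ℂ) (h3 : R1.IMCEqFrameOnTree W p) : R1OpenInputOnTreeAt W p := by
  intro _ q _ K _ _ Dt H ιK P hE hr hqp hmq hns hvq hK hCas hP hc hinf κ hκ γ _ 𝔭 h𝔭 he hf
  have hC : R1ControlOnTreeAt W p :=
    r1ControlOnTreeAt_of_poitouTateAtoms_of_anticyclotomicDecomposition W p hBr
      (r1PoitouTateAtomsAt_of_twoAtoms W p hPT hEP
        (r1TwoAtomsAt_of_baseSelmerCount W p hPT hPT2 hEP hcd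
          (r1BaseSelmerCountAt_of_facts W p hGZK hmod hPT hEP)))
  obtain ⟨n, hn, -⟩ := hC q K Dt H ιK P hE hr hqp hmq hns hvq hK hCas hP hc hinf κ hκ γ 𝔭 h𝔭 he hf
  obtain ⟨w₀⟩ := (inferInstance : Nonempty (InfinitePlace K))
  have hnd : ¬ (p : ℤ) ∣ W.LFunction p := R1.not_dvd_lFunction_of_mult Dt.isNewformOf hE.2.1
  have hp2 : p ≠ 2 := by have := hE.1; omega
  -- `rank_ℤ E(K) = 1` on the erratum field (Gross–Zagier–Kolyvagin)
  have hrk : (W.baseChange K).mordellWeilRank = 1 :=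
    (IsErratumField.mordellWeilRank_eq_one_and_shaFinite W hGZK hmod hr hK).1
  -- the datum's complex embedding is `w₀.embedding ∘ τ` for some `τ ∈ Gal(K/ℚ)`, `τ² = 1`
  haveI : IsGalois ℚ K := by
    haveI : Algebra.IsQuadraticExtension ℚ K := ⟨hK.1.1⟩
    infer_instance
  obtain ⟨σ, hσ⟩ := ComplexEmbedding.exists_comp_symm_eq_of_comp_eq (k := ℚ) w₀.embedding ιK
    (by ext x; simp)
  set τ : K →+* K := ((σ.symm : K ≃ₐ[ℚ] K) : K →+* K) with hτdef
  have hτ : ∀ x, τ (τ x) = x := by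
    intro x
    have hcard : Nat.card (K ≃ₐ[ℚ] K) = 2 := by rw [IsGalois.card_aut_eq_finrank, hK.1.1]
    have hsq : σ.symm * σ.symm = 1 := by
      have h := pow_card_eq_one' (G := K ≃ₐ[ℚ] K) (x := σ.symm)
      rwa [hcard, pow_two] at h
    have := congrArg (fun g : K ≃ₐ[ℚ] K ↦ g x) hsq
    simpa [hτdef, AlgEquiv.mul_apply] using this
  -- the Galois conjugate `P' = τ_* P` is the Heegner point read through `w₀.embedding`
  set P' := WeierstrassCurve.Affine.Point.map τ.toRatAlgHom P with hP'def
  have hP' : WeierstrassCurve.Affine.Point.map w₀.embedding.toRatAlgHom P' =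
      heegnerPointComplex Dt H := by
    rw [hP'def, WeierstrassCurve.Affine.Point.map_map]
    have hcomp : w₀.embedding.toRatAlgHom.comp τ.toRatAlgHom = ιK.toRatAlgHom := by
      apply AlgHom.ext
      intro x
      have := RingHom.congr_fun hσ x
      simpa [hτdef] using this
    rw [hcomp]
    exact hP
  -- `P'` has infinite order too (`τ_*` is an injective group homomorphism)
  have hinf' : ¬ IsOfFinAddOrder P' := fun h ↦ hinf
    ((WeierstrassCurve.Affine.Point.map_injective (f := τ.toRatAlgHom)).isOfFinAddOrder_iff.mp
      (by simpa [hP'def] using h))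
  -- `ord_p log P' = ord_p log P` along any embedding
  have hlog : ∀ e : K →+* ℚ_[p], padicLogOrd W p e P' = padicLogOrd W p e P := fun e ↦
    R1.padicLogOrd_map_eq_of_rank_one W p e P hp2 τ hτ hrk hinf
  -- THE embedding at `𝔭` induces `𝔭`
  have hemb : ∀ k : 𝓞 K, k ∈ 𝔭.asIdeal ↔ ‖embAt K p 𝔭 h𝔭 he hf (k : K)‖ < 1 :=
    mem_asIdeal_iff_norm_embAt_lt_one 𝔭 h𝔭 he hf
  -- every degree-one prime above `p` is induced by `ι` or by `ι ∘ conj`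
  have key : ∀ ι' : PadicAlgCl p ≃+* ℂ, 𝔭 = primeOfEmbeddingDatum p ι' w₀.embedding →
      IMCWaldspurgerOnTreeAt p κ 𝔭 γ (embAt K p 𝔭 h𝔭 he hf) P := by
    intro ι' h𝔭eq
    subst h𝔭eq
    obtain ⟨ΩK, Ωp, L, -, -, h2, h3At⟩ :=
      h3 q K Dt H w₀ P' hE hr hqp hmq hns hvq hK hCas hP' hc hinf' κ hκ γ ι' _ hemb
    refine R1.imcWaldspurgerOnTreeAt_of_padicLogOrd_eq W p _ (hlog _) ?_
    exact R1.imcWaldspurgerOnTreeAt_of_halves hn h3At hnd h2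
  rcases eq_primeOfEmbeddingDatum_or_eq_trans_starRingAut p ι hK.1 w₀ h𝔭 with h | h
  · exact key ι h
  · exact key _ h

/-- **Route R1's open input from H3∃ — no embedding datum** (Steinitz:
`PadicAlgCl.nonempty_ringEquiv_complex`). CONDITIONAL on H3∃ (open).
[cite: Castella2018, Thms. 2.3, 3.1, 3.2 and §5 (arXiv:1704.06608 pp. 5, 9, 12)]
[cite: Castella2018Erratum, Thm. 1.1 (p. 1)] -/
theorem R1.openInputOnTreeAt_of_imcEqFrame'
    (hmod : exists_isNewformOf) (hGZK : rank_eq_analyticRank_of_analyticRank_le_one)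
    (hPT : ∀ (K : Type) [Field K] [NumberField K], poitouTate_selmerStructure_duality K)
    (hPT2 : ∀ (K : Type) [Field K] [NumberField K], poitouTate_sha_tateDual K)
    (hEP : ∀ (K : Type) [Field K] [NumberField K] (v : HeightOneSpectrum (𝓞 K)),
      localEulerPoincareCharacteristic (v.adicCompletion K))
    (hcd : fieldCdLE_two_of_numberField)
    (hBr : ∀ (K : Type) [Field K] [NumberField K] (p : ℕ) [Fact p.Prime],
      ZpExtension.decomp_not_le_kerSubgroup_of_isAnticyclotomic K p)
    (h3 : R1.IMCEqFrameOnTree W p) : R1OpenInputOnTreeAt W p := by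
  obtain ⟨ι⟩ := PadicAlgCl.nonempty_ringEquiv_complex p
  exact R1.openInputOnTreeAt_of_imcEqFrame hmod hGZK hPT hPT2 hEP hcd hBr ι h3

/-- **Route R1 — THE RECORD IN FRAME FORM (gen 22): all of `R1Population ∩ {r_an = 1}`, `p ≥ 5`,
7 PUBLISHED + 5 CITED + ONE OPEN input, no semistability hypothesis, no auxiliary datum.** For every
globally minimal elliptic `W/ℚ` and prime `p` on `R1Population` with `ord_{s=1} L(E,s) = 1`:
`BSD(E,p)`, from the SEVEN PUBLISHED named facts `hGZ` (Gross–Zagier 1986 I.7.3), `hGZK`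
(Gross–Zagier–Kolyvagin), `hSk` (Skinner 2016 Thm. C), `hmod` (modularity), `hCST` (Cai–Shu–Tian
2014 Thm. 1.1), `hFH` (Friedberg–Hoffstein 1995 Thm. B), `hMaz` (Mazur 1978 Cor. 4.1), the FIVE CITED
cohomological facts `hPT hPT2 hEP hcd hBr`, and the ONE OPEN input `h3 : R1.IMCEqFrameOnTree W p`
(per datum: a BDP frame with Cas18 Thm. 3.1's interpolation property, Thm. 3.2's value at `𝟙` and
erratum Thm. 1.1's main-conjecture equality). HONEST CONTENT of the open input: on SEMISTABLE pairs
its Thm. 3.1 ∧ 3.2 part is the registered published fact and what is open is erratum Thm. 1.1 for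
Castella's `L_p(f)` (⇐ [FW21, Thm. 4.41], PREPRINT); on NON-semistable pairs all three conjuncts are
unrefereed ([Castella 2024, Thm. 3.1, §2.3], PREPRINT). CONDITIONAL; deletes nothing; X11b stays
CONSTRUCTION-SHAPED; no label change. [cite: Castella2018, §5 (arXiv:1704.06608 p. 12)]
[cite: Castella2018Erratum, Thm. 1.1, Thm. A′ (p. 1)] -/
theorem R1.bsdp_of_imcEqFrame_record
    (hGZ : GrossZagier1986_thm_I_7_3) (hGZK : rank_eq_analyticRank_of_analyticRank_le_one)
    (hSk : Skinner2016.thmC_padicValRat_bsd_rank_zero) (hmod : exists_isNewformOf)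
    (hCST : CaiShuTian2014.thm11_trivialChar)
    (hFH : friedbergHoffstein_exists_twist_ne_zero_ramifiedAt)
    (hMaz : mazur_not_dvd_maninConstant_of_odd)
    (hPT : ∀ (K : Type) [Field K] [NumberField K], poitouTate_selmerStructure_duality K)
    (hPT2 : ∀ (K : Type) [Field K] [NumberField K], poitouTate_sha_tateDual K)
    (hEP : ∀ (K : Type) [Field K] [NumberField K] (v : HeightOneSpectrum (𝓞 K)),
      localEulerPoincareCharacteristic (v.adicCompletion K))
    (hcd : fieldCdLE_two_of_numberField)
    (hBr : ∀ (K : Type) [Field K] [NumberField K] (p : ℕ) [Fact p.Prime],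
      ZpExtension.decomp_not_le_kerSubgroup_of_isAnticyclotomic K p)
    (h3 : R1.IMCEqFrameOnTree W p) (hW : R1Population W p) (hr : W.analyticRank = 1) :
    BSDp W p :=
  (R1.openInputOnTreeAt_iff_bsdp_final (W := W) (p := p) hGZ hGZK hSk hmod hCST hFH hMaz hPT hPT2
      hEP hcd hBr hW hr).mp
    (R1.openInputOnTreeAt_of_imcEqFrame' hmod hGZK hPT hPT2 hEP hcd hBr h3)

/-- **Both sides of gen 19's tightness hold under H3∃** on `R1Population ∩ {r_an = 1}`: the open
input `R1OpenInputOnTreeAt W p` AND `BSDp W p`. CONDITIONAL on H3∃ (open).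
[cite: Castella2018, §5 (arXiv:1704.06608 p. 12)] [cite: Castella2018Erratum, Thm. 1.1 (p. 1)] -/
theorem R1.openInput_and_bsdp_of_imcEqFrame_record
    (hGZ : GrossZagier1986_thm_I_7_3) (hGZK : rank_eq_analyticRank_of_analyticRank_le_one)
    (hSk : Skinner2016.thmC_padicValRat_bsd_rank_zero) (hmod : exists_isNewformOf)
    (hCST : CaiShuTian2014.thm11_trivialChar)
    (hFH : friedbergHoffstein_exists_twist_ne_zero_ramifiedAt)
    (hMaz : mazur_not_dvd_maninConstant_of_odd)
    (hPT : ∀ (K : Type) [Field K] [NumberField K], poitouTate_selmerStructure_duality K)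
    (hPT2 : ∀ (K : Type) [Field K] [NumberField K], poitouTate_sha_tateDual K)
    (hEP : ∀ (K : Type) [Field K] [NumberField K] (v : HeightOneSpectrum (𝓞 K)),
      localEulerPoincareCharacteristic (v.adicCompletion K))
    (hcd : fieldCdLE_two_of_numberField)
    (hBr : ∀ (K : Type) [Field K] [NumberField K] (p : ℕ) [Fact p.Prime],
      ZpExtension.decomp_not_le_kerSubgroup_of_isAnticyclotomic K p)
    (h3 : R1.IMCEqFrameOnTree W p) (hW : R1Population W p) (hr : W.analyticRank = 1) :
    R1OpenInputOnTreeAt W p ∧ BSDp W p :=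
  ⟨R1.openInputOnTreeAt_of_imcEqFrame' hmod hGZK hPT hPT2 hEP hcd hBr h3,
    R1.bsdp_of_imcEqFrame_record hGZ hGZK hSk hmod hCST hFH hMaz hPT hPT2 hEP hcd hBr h3 hW hr⟩

end ClassLevel

end Summit.BirchSwinnertonDyer.Rank1Residual.X11b

end
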